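import Summits.CriticalPhenomena.Ising3DConformalLimit.Theorems.TwinThreshold.Negative.TwinThresholdSeamEvenness
import Summits.CriticalPhenomena.Ising3DConformalLimit.Theorems.ReflectionTwinTwinThresholdStrongSeamOrder
import Summits.CriticalPhenomena.Ising3DConformalLimit.Theorems.ReflectionTwinTwinTransparencyTwinBoxMonotone

/-!
# `TwinThreshold` (stmt-CriticalPhenomena-16906), line `seam_renewal` — BOTH guards of the open stub (C2)
# `stub_bubbleIntegrable` are load-bearing

Refuter (crux-disprover) negative-lane lemmas, theorem-only, ζβ-reduced closed terms (same currency as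
`TwinThresholdSeamEvenness.lean`). Stub (C2) of `Cruxes/TwinThreshold/Lines/seam_renewal.lean` asks for a locally
integrable majorant `Bf` of the THICK-PLANE BUBBLE `∑_{u ∈ box L, h u ∈ {-1,0,1}} ⟨σ_xσ_u⟩²_{TW(J), box L}` (plane base
points `x`), demanded only at couplings `J` with `0 ≤ J` (the SIGN guard) that lie strictly below a plane-disordered
coupling, `J < J'' ∧ ¬ LRO J''` (the DISORDER guard). Nothing here touches (C2) itself; we certify that each guard
carries weight, from ingredients already in the tree:

* `planeBubble_unbounded_of_lro` — at a coupling `J ≥ 0` with plane long-range order (`inf_c sup_L ⟨σ₀σ_c⟩ ≥ m > 0`)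
  the plane part of the bubble at the base point `0` is UNBOUNDED over boxes: `N` diagonal plane sites `(n,-n,0)` each
  reach `⟨σ₀σ_c⟩_{box L} > m/2` in one common box by Griffiths volume monotonicity of the free twin boxes
  (`stub_twinBoxMonotone`, landed for `TwinTransparency`), so the bubble exceeds `N m²/4`.
* `exists_pos_lro` — a STRICTLY positive ordered coupling exists: stub (S) `stub_strongSeamOrder` (landed, p168573)
  gives `J₀ ≥ 0` with `LRO J₀`, and `J₀ ≠ 0` by the `J = 0` anchor `not_lro_zero`.
* `stub_bubbleIntegrable_false_without_disorderGuard` — delete `J < J'' → ¬ LRO J''`: the majorant would have to bound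
  the bubble at `J₀`, which is unbounded. FALSE.
* `stub_bubbleIntegrable_false_without_nonnegGuard` — delete `0 ≤ J`: the coupling `-J₀ < 0` lies below the
  DISORDERED coupling `J'' = 0`, so the majorant would have to bound the bubble at `-J₀`; but the plane gauge
  (`PairIsing.gibbsAvg_gauge`, `cpl_planeGauge`) makes every plane–plane box correlator EVEN in `J`
  (`boxPair_neg_plane`), so the plane part of the bubble at `-J₀` equals that at `J₀`, unbounded. FALSE.
  (So (C2), like (M), is a statement about `J ≥ 0` only, and its disorder guard is what keeps it off `[J*, ∞)`.)
-/

noncomputable section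

namespace Summit.CriticalPhenomena.Ising3DConformalLimit.Theorems.TwinThreshold.Negative

open scoped BigOperators
open Literature.Probability.LatticeModels

/-! ## Diagonal plane sites `(n, -n, 0)` -/

/-- `(n,-n,0)` lies in the box of radius `L ≥ n`. [folklore] -/
theorem planeDiag_mem_box {n L : ℕ} (h : n ≤ L) : (![((n : ℕ) : ℤ), -(((n : ℕ) : ℤ)), 0] : Site 3) ∈ box 3 L := by
  rw [mem_box]
  intro i
  fin_cases i <;> simp <;> omega

/-- `(n,-n,0)` is a plane site. [folklore] -/
theorem planeDiag_plane (n : ℕ) : (![((n : ℕ) : ℤ), -(((n : ℕ) : ℤ)), 0] : Site 3) 0 + (![((n : ℕ) : ℤ), -(((n : ℕ) : ℤ)), 0] : Site 3) 1 + (![((n : ℕ) : ℤ), -(((n : ℕ) : ℤ)), 0] : Site 3) 2 = 0 := by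
  simp

/-- `n ↦ (n,-n,0)` is injective. [folklore] -/
theorem planeDiag_injective {n n' : ℕ} (h : (![((n : ℕ) : ℤ), -(((n : ℕ) : ℤ)), 0] : Site 3) = (![((n' : ℕ) : ℤ), -(((n' : ℕ) : ℤ)), 0] : Site 3)) : n = n' := by
  have h0 := congrFun h 0
  simpa using h0

/-! ## The two spellings of the box two-point function, and its evenness in `J` on plane pairs -/

/-- With both points in the box, the junk-padded product observable `∏ᵢ σ_{zᵢ}` for `z = ![0, c]` is the plain
product `σ₀σ_c`. [folklore] -/
theorem obsTwo_eq_spinPair (L : ℕ) (c : Site 3) (hc : c ∈ box 3 L) :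
    (fun s => ∏ i, if h : (![(0 : Site 3), c] : Fin 2 → Site 3) i ∈ box 3 L then spinAt (⟨(![(0 : Site 3), c] : Fin 2 → Site 3) i, h⟩ : ↥(box 3 L)) s else 0) = fun s => spinAt (⟨(0 : Site 3), zero_mem_box 3 L⟩ : ↥(box 3 L)) s * spinAt (⟨c, hc⟩ : ↥(box 3 L)) s := by
  funext s
  simp only [Fin.prod_univ_two, Matrix.cons_val_zero, Matrix.cons_val_one]
  rw [dif_pos (zero_mem_box 3 L), dif_pos hc]

/-- The plane gauge fixes `σ_xσ_u` for plane sites `x, u` (two sign flips). [folklore] -/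
theorem spinPair_planeGauge (L : ℕ) (x u : ↥(box 3 L)) (hx : x.1 0 + x.1 1 + x.1 2 = 0) (hu : u.1 0 + u.1 1 + u.1 2 = 0) (s : SpinConfig ↥(box 3 L)) :
    spinAt x (fun a : ↥(box 3 L) => (if a.1 0 + a.1 1 + a.1 2 = 0 then (-1 : ℤˣ) else 1) * s a) * spinAt u (fun a : ↥(box 3 L) => (if a.1 0 + a.1 1 + a.1 2 = 0 then (-1 : ℤˣ) else 1) * s a) = spinAt x s * spinAt u s := by
  rw [PairIsing.spinAt_gauge, PairIsing.spinAt_gauge, planeSign_cast, planeSign_cast, if_pos hx, if_pos hu]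
  ring

/-- **Plane–plane box correlators are even in the seam coupling**: `⟨σ_xσ_u⟩_{TW(-J), box L} = ⟨σ_xσ_u⟩_{TW(J), box L}`
for plane sites `x, u` (gauge transport by the plane sign; every `J`-bond has exactly one endpoint on the plane).
[folklore] -/
theorem boxPair_neg_plane (J : ℝ) (L : ℕ) (x u : ↥(box 3 L)) (hx : x.1 0 + x.1 1 + x.1 2 = 0) (hu : u.1 0 + u.1 1 + u.1 2 = 0) :
    PairIsing.gibbsAvg (fun a b : ↥(box 3 L) => if (((∑ i, |a.1 i - b.1 i| = 1) ∧ ¬ ((a.1 0 + a.1 1 + a.1 2 = 0 ∧ b.1 0 + b.1 1 + b.1 2 = 1) ∨ (a.1 0 + a.1 1 + a.1 2 = 1 ∧ b.1 0 + b.1 1 + b.1 2 = 0))) ∨ (((a.1 0 + a.1 1 + a.1 2 = 0 ∧ b.1 0 + b.1 1 + b.1 2 = 1) ∨ (a.1 0 + a.1 1 + a.1 2 = 1 ∧ b.1 0 + b.1 1 + b.1 2 = 0)) ∧ ∃ i : Fin 3, a.1 + b.1 = Pi.single i 1)) then (criticalBeta 3 / 2) * (if a.1 0 + a.1 1 + a.1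 2 = 0 ∨ b.1 0 + b.1 1 + b.1 2 = 0 then (-J) else 1) else 0) (fun s => spinAt x s * spinAt u s) = PairIsing.gibbsAvg (fun a b : ↥(box 3 L) => if (((∑ i, |a.1 i - b.1 i| = 1) ∧ ¬ ((a.1 0 + a.1 1 + a.1 2 = 0 ∧ b.1 0 + b.1 1 + b.1 2 = 1) ∨ (a.1 0 + a.1 1 + a.1 2 = 1 ∧ b.1 0 + b.1 1 + b.1 2 = 0))) ∨ (((a.1 0 + a.1 1 + a.1 2 = 0 ∧ b.1 0 + b.1 1 + b.1 2 = 1) ∨ (a.1 0 + a.1 1 + a.1 2 = 1 ∧ b.1 0 + b.1 1 + b.1 2 = 0)) ∧ ∃ i : Fin 3, a.1 + b.1 = Pi.single i 1)) then (criticalBeta 3 / 2) * (if a.1 0 + a.1 1 + a.1 2 = 0 ∨ b.1 0 + b.1 1 + b.1 2 = 0 then J else 1) else 0) (fun s => spinAt x s * spinAt u s) := by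
  symm
  rw [PairIsing.gibbsAvg_gauge (fun a : ↥(box 3 L) => (if a.1 0 + a.1 1 + a.1 2 = 0 then (-1 : ℤˣ) else 1))]
  congr 1
  · funext a b
    exact cpl_planeGauge J L a b
  · funext s
    exact spinPair_planeGauge L x u hx hu s

/-- The plane part of the thick-plane bubble at base point `0` is even in `J`. [folklore] -/
theorem planeBubble_neg (J : ℝ) (L : ℕ) :
    (∑ u : ↥(box 3 L), if u.1 0 + u.1 1 + u.1 2 = 0 then PairIsing.gibbsAvg (fun a b : ↥(box 3 L) => if (((∑ i, |a.1 i - b.1 i| = 1) ∧ ¬ ((a.1 0 + a.1 1 + a.1 2 = 0 ∧ b.1 0 + b.1 1 + b.1 2 = 1) ∨ (a.1 0 + a.1 1 + a.1 2 = 1 ∧ b.1 0 + b.1 1 + b.1 2 = 0))) ∨ (((a.1 0 + a.1 1 + a.1 2 = 0 ∧ b.1 0 + b.1 1 + b.1 2 = 1) ∨ (a.1 0 + a.1 1 + a.1 2 = 1 ∧ b.1 0 + b.1 1 + b.1 2 = 0)) ∧ ∃ i : Fin 3, a.1 + b.1 = Pi.single i 1)) then (criticalBeta 3 / 2) * (if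 a.1 0 + a.1 1 + a.1 2 = 0 ∨ b.1 0 + b.1 1 + b.1 2 = 0 then (-J) else 1) else 0) (fun s => spinAt (⟨(0 : Site 3), zero_mem_box 3 L⟩ : ↥(box 3 L)) s * spinAt u s) ^ 2 else 0) = (∑ u : ↥(box 3 L), if u.1 0 + u.1 1 + u.1 2 = 0 then PairIsing.gibbsAvg (fun a b : ↥(box 3 L) => if (((∑ i, |a.1 i - b.1 i| = 1) ∧ ¬ ((a.1 0 + a.1 1 + a.1 2 = 0 ∧ b.1 0 + b.1 1 + b.1 2 = 1) ∨ (a.1 0 + a.1 1 + a.1 2 = 1 ∧ b.1 0 + b.1 1 + b.1 2 = 0))) ∨ (((a.1 0 + a.1 1 + a.1 2 = 0 ∧ b.1 0 + b.1 1 + b.1 2 = 1) ∨ (a.1 0 + a.1 1 + a.1 2 = 1 ∧ b.1 0 + b.1 1 + b.1 2 = 0)) ∧ ∃ i : Fin 3, a.1 + b.1 = Pi.single i 1)) then (criticalBeta 3 / 2) * (if a.1 0 + a.1 1 + a.1 2 = 0 ∨ b.1 0 + b.1 1 + b.1 2 = 0 then J else 1) else 0) (fun s => spinAt (⟨(0 :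 Site 3), zero_mem_box 3 L⟩ : ↥(box 3 L)) s * spinAt u s) ^ 2 else 0) := by
  refine Finset.sum_congr rfl fun u _ => ?_
  have hx0 : (⟨(0 : Site 3), zero_mem_box 3 L⟩ : ↥(box 3 L)).1 0 + (⟨(0 : Site 3), zero_mem_box 3 L⟩ : ↥(box 3 L)).1 1 + (⟨(0 : Site 3), zero_mem_box 3 L⟩ : ↥(box 3 L)).1 2 = 0 := by simp
  split_ifs with hu
  · rw [boxPair_neg_plane J L (⟨(0 : Site 3), zero_mem_box 3 L⟩ : ↥(box 3 L)) u hx0 hu]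
  · rfl

/-- The plane part of the bubble is below the thick-plane bubble (plane sites are thick; squares are nonnegative). [folklore] -/
theorem planeBubble_le_bubble (J : ℝ) (L : ℕ) :
    (∑ u : ↥(box 3 L), if u.1 0 + u.1 1 + u.1 2 = 0 then PairIsing.gibbsAvg (fun a b : ↥(box 3 L) => if (((∑ i, |a.1 i - b.1 i| = 1) ∧ ¬ ((a.1 0 + a.1 1 + a.1 2 = 0 ∧ b.1 0 + b.1 1 + b.1 2 = 1) ∨ (a.1 0 + a.1 1 + a.1 2 = 1 ∧ b.1 0 + b.1 1 + b.1 2 = 0))) ∨ (((a.1 0 + a.1 1 + a.1 2 = 0 ∧ b.1 0 + b.1 1 + b.1 2 = 1) ∨ (a.1 0 + a.1 1 + a.1 2 = 1 ∧ b.1 0 + b.1 1 + b.1 2 = 0)) ∧ ∃ i : Fin 3, a.1 + b.1 = Pi.single i 1)) then (criticalBeta 3 / 2) * (if a.1 0 + a.1 1 + a.1 2 = 0 ∨ b.1 0 + b.1 1 + b.1 2 = 0 then J else 1) else 0) (fun s => spinAt (⟨(0 : Site 3), zero_mem_box 3 L⟩ : ↥(box 3 L)) s * spinAt u s) ^ 2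 else 0) ≤ (∑ u : ↥(box 3 L), if (u.1 0 + u.1 1 + u.1 2 = -1 ∨ u.1 0 + u.1 1 + u.1 2 = 0 ∨ u.1 0 + u.1 1 + u.1 2 = 1) then PairIsing.gibbsAvg (fun a b : ↥(box 3 L) => if (((∑ i, |a.1 i - b.1 i| = 1) ∧ ¬ ((a.1 0 + a.1 1 + a.1 2 = 0 ∧ b.1 0 + b.1 1 + b.1 2 = 1) ∨ (a.1 0 + a.1 1 + a.1 2 = 1 ∧ b.1 0 + b.1 1 + b.1 2 = 0))) ∨ (((a.1 0 + a.1 1 + a.1 2 = 0 ∧ b.1 0 + b.1 1 + b.1 2 = 1) ∨ (a.1 0 + a.1 1 + a.1 2 = 1 ∧ b.1 0 + b.1 1 + b.1 2 = 0)) ∧ ∃ i : Fin 3, a.1 + b.1 = Pi.single i 1)) then (criticalBeta 3 / 2) * (if a.1 0 + a.1 1 + a.1 2 = 0 ∨ b.1 0 + b.1 1 + b.1 2 = 0 then J else 1) else 0) (fun s => spinAt (⟨(0 : Site 3), zero_mem_box 3 L⟩ : ↥(box 3 L)) s * spinAt u s) ^ 2 else 0) := by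
  refine Finset.sum_le_sum fun u _ => ?_
  by_cases hu : u.1 0 + u.1 1 + u.1 2 = 0
  · rw [if_pos hu, if_pos (Or.inr (Or.inl hu))]
  · rw [if_neg hu]
    split_ifs
    · exact sq_nonneg _
    · exact le_rfl

/-! ## Plane order makes the bubble unbounded over boxes -/

/-- **At an ordered coupling the plane bubble is unbounded over boxes.** If `0 ≤ J` and `⟨σ₀σ_c⟩_{TW(J)} ≥ m > 0` for
every plane site `c` (sup over free boxes), then for every `B` some box has `∑_{u plane} ⟨σ₀σ_u⟩²_{box L} > B`:
take `N > 4B/m²` diagonal sites `(n,-n,0)`, a box for each in which its correlator exceeds `m/2` (`lt_ciSup_iff`), and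
one common larger box by volume monotonicity of the free twin boxes (`stub_twinBoxMonotone`). [folklore] -/
theorem planeBubble_unbounded_of_lro {J m : ℝ} (hJ : 0 ≤ J) (hm : 0 < m)
    (hLRO : ∀ c : Site 3, c 0 + c 1 + c 2 = 0 → m ≤ (⨆ L : ℕ, PairIsing.gibbsAvg (fun a b : ↥(box 3 L) => if (((∑ i, |a.1 i - b.1 i| = 1) ∧ ¬ ((a.1 0 + a.1 1 + a.1 2 = 0 ∧ b.1 0 + b.1 1 + b.1 2 = 1) ∨ (a.1 0 + a.1 1 + a.1 2 = 1 ∧ b.1 0 + b.1 1 + b.1 2 = 0))) ∨ (((a.1 0 + a.1 1 + a.1 2 = 0 ∧ b.1 0 + b.1 1 + b.1 2 = 1) ∨ (a.1 0 + a.1 1 + a.1 2 = 1 ∧ b.1 0 + b.1 1 + b.1 2 = 0)) ∧ ∃ i : Fin 3, a.1 + b.1 = Pi.single i 1)) then (criticalBeta 3 / 2) * (if a.1 0 + a.1 1 + a.1 2 = 0 ∨ b.1 0 + b.1 1 + b.1 2 = 0 then J else 1) else 0) (fun s => ∏ i, if h : (![(0 : Site 3), c] : Fin 2 → Site 3) i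 ∈ box 3 L then spinAt (⟨(![(0 : Site 3), c] : Fin 2 → Site 3) i, h⟩ : ↥(box 3 L)) s else 0))) (B : ℝ) :
    ∃ L : ℕ, B < (∑ u : ↥(box 3 L), if u.1 0 + u.1 1 + u.1 2 = 0 then PairIsing.gibbsAvg (fun a b : ↥(box 3 L) => if (((∑ i, |a.1 i - b.1 i| = 1) ∧ ¬ ((a.1 0 + a.1 1 + a.1 2 = 0 ∧ b.1 0 + b.1 1 + b.1 2 = 1) ∨ (a.1 0 + a.1 1 + a.1 2 = 1 ∧ b.1 0 + b.1 1 + b.1 2 = 0))) ∨ (((a.1 0 + a.1 1 + a.1 2 = 0 ∧ b.1 0 + b.1 1 + b.1 2 = 1) ∨ (a.1 0 + a.1 1 + a.1 2 = 1 ∧ b.1 0 + b.1 1 + b.1 2 = 0)) ∧ ∃ i : Fin 3, a.1 + b.1 = Pi.single i 1)) then (criticalBeta 3 / 2) * (if a.1 0 + a.1 1 + a.1 2 = 0 ∨ b.1 0 + b.1 1 + b.1 2 = 0 then J else 1) else 0) (fun s => spinAt (⟨(0 : Site 3), zero_mem_box 3 L⟩ : ↥(box 3 L)) s * spinAt u s)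 ^ 2 else 0) := by
  have hmono := Summit.CriticalPhenomena.Ising3DConformalLimit.Cruxes.TwinTransparency.ReplicaMirror.stub_twinBoxMonotone
  beta_reduce at hmono
  obtain ⟨hvol, -, hbd⟩ := hmono
  have hm2 : 0 < (m / 2) ^ 2 := by positivity
  obtain ⟨N, hN⟩ := exists_nat_gt (B / (m / 2) ^ 2)
  have hBN : B < (N : ℝ) * (m / 2) ^ 2 := by rwa [div_lt_iff₀ hm2] at hN
  -- one box per diagonal site
  have hsite : ∀ n : ℕ, ∃ L : ℕ, n ≤ L ∧ m / 2 < PairIsing.gibbsAvg (fun a b : ↥(box 3 L) => if (((∑ i, |a.1 i - b.1 i| = 1) ∧ ¬ ((a.1 0 + a.1 1 + a.1 2 = 0 ∧ b.1 0 + b.1 1 + b.1 2 = 1) ∨ (a.1 0 + a.1 1 + a.1 2 = 1 ∧ b.1 0 + b.1 1 + b.1 2 = 0))) ∨ (((a.1 0 + a.1 1 + a.1 2 = 0 ∧ b.1 0 + b.1 1 + b.1 2 = 1) ∨ (a.1 0 + a.1 1 + a.1 2 = 1 ∧ b.1 0 + b.1 1 + b.1 2 = 0)) ∧ ∃ i :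 Fin 3, a.1 + b.1 = Pi.single i 1)) then (criticalBeta 3 / 2) * (if a.1 0 + a.1 1 + a.1 2 = 0 ∨ b.1 0 + b.1 1 + b.1 2 = 0 then J else 1) else 0) (fun s => ∏ i, if h : (![(0 : Site 3), (![((n : ℕ) : ℤ), -(((n : ℕ) : ℤ)), 0] : Site 3)] : Fin 2 → Site 3) i ∈ box 3 L then spinAt (⟨(![(0 : Site 3), (![((n : ℕ) : ℤ), -(((n : ℕ) : ℤ)), 0] : Site 3)] : Fin 2 → Site 3) i, h⟩ : ↥(box 3 L)) s else 0) := by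
    intro n
    have hbdd : BddAbove (Set.range fun L : ℕ => PairIsing.gibbsAvg (fun a b : ↥(box 3 L) => if (((∑ i, |a.1 i - b.1 i| = 1) ∧ ¬ ((a.1 0 + a.1 1 + a.1 2 = 0 ∧ b.1 0 + b.1 1 + b.1 2 = 1) ∨ (a.1 0 + a.1 1 + a.1 2 = 1 ∧ b.1 0 + b.1 1 + b.1 2 = 0))) ∨ (((a.1 0 + a.1 1 + a.1 2 = 0 ∧ b.1 0 + b.1 1 + b.1 2 = 1) ∨ (a.1 0 + a.1 1 + a.1 2 = 1 ∧ b.1 0 + b.1 1 + b.1 2 = 0)) ∧ ∃ i : Fin 3, a.1 + b.1 = Pi.single i 1)) then (criticalBeta 3 / 2) * (if a.1 0 + a.1 1 + a.1 2 = 0 ∨ b.1 0 + b.1 1 + b.1 2 = 0 then J else 1) else 0) (fun s => ∏ i, if h : (![(0 : Site 3), (![((n : ℕ) : ℤ), -(((n : ℕ) : ℤ)), 0] : Site 3)] : Fin 2 → Site 3) i ∈ box 3 L then spinAt (⟨(![(0 : Site 3), (![((n : ℕ) : ℤ), -(((n : ℕ) : ℤ)), 0] : Site 3)] : Fin 2 →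 Site 3) i, h⟩ : ↥(box 3 L)) s else 0)) := by
      refine ⟨1, ?_⟩
      rintro _ ⟨L, rfl⟩
      exact (abs_le.mp (hbd J 2 (![(0 : Site 3), (![((n : ℕ) : ℤ), -(((n : ℕ) : ℤ)), 0] : Site 3)] : Fin 2 → Site 3) L)).2
    have hlt : m / 2 < (⨆ L : ℕ, PairIsing.gibbsAvg (fun a b : ↥(box 3 L) => if (((∑ i, |a.1 i - b.1 i| = 1) ∧ ¬ ((a.1 0 + a.1 1 + a.1 2 = 0 ∧ b.1 0 + b.1 1 + b.1 2 = 1) ∨ (a.1 0 + a.1 1 + a.1 2 = 1 ∧ b.1 0 + b.1 1 + b.1 2 = 0))) ∨ (((a.1 0 + a.1 1 + a.1 2 = 0 ∧ b.1 0 + b.1 1 + b.1 2 = 1) ∨ (a.1 0 + a.1 1 + a.1 2 = 1 ∧ b.1 0 + b.1 1 + b.1 2 = 0)) ∧ ∃ i : Fin 3, a.1 + b.1 = Pi.single i 1)) then (criticalBeta 3 / 2) * (if a.1 0 + a.1 1 + a.1 2 = 0 ∨ b.1 0 + b.1 1 + b.1 2 = 0 then J else 1) else 0) (fun s => ∏ i,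 if h : (![(0 : Site 3), (![((n : ℕ) : ℤ), -(((n : ℕ) : ℤ)), 0] : Site 3)] : Fin 2 → Site 3) i ∈ box 3 L then spinAt (⟨(![(0 : Site 3), (![((n : ℕ) : ℤ), -(((n : ℕ) : ℤ)), 0] : Site 3)] : Fin 2 → Site 3) i, h⟩ : ↥(box 3 L)) s else 0)) :=
      lt_of_lt_of_le (by linarith) (hLRO (![((n : ℕ) : ℤ), -(((n : ℕ) : ℤ)), 0] : Site 3) (planeDiag_plane n))
    obtain ⟨L, hL⟩ := (lt_ciSup_iff hbdd).mp hlt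
    exact ⟨max n L, le_max_left _ _, hL.trans_le (hvol J 2 (![(0 : Site 3), (![((n : ℕ) : ℤ), -(((n : ℕ) : ℤ)), 0] : Site 3)] : Fin 2 → Site 3) L (max n L) hJ (le_max_right _ _))⟩
  choose Lf hLf using hsite
  -- a common box
  refine ⟨∑ n ∈ Finset.range N, Lf n, ?_⟩
  have hLf_le : ∀ n, n < N → Lf n ≤ ∑ k ∈ Finset.range N, Lf k := fun n hn =>
    Finset.single_le_sum (f := Lf) (fun _ _ => Nat.zero_le _) (Finset.mem_range.mpr hn)
  have hmem : ∀ n : Fin N, (![(((n : ℕ) : ℕ) : ℤ), -((((n : ℕ) : ℕ) : ℤ)), 0] : Site 3) ∈ box 3 (∑ k ∈ Finset.range N, Lf k) :=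
    fun n => planeDiag_mem_box ((hLf n).1.trans (hLf_le n n.2))
  have hinj : ∀ a ∈ (Finset.univ : Finset (Fin N)), ∀ b ∈ (Finset.univ : Finset (Fin N)),
      (fun n : Fin N => (⟨(![(((n : ℕ) : ℕ) : ℤ), -((((n : ℕ) : ℕ) : ℤ)), 0] : Site 3), hmem n⟩ : ↥(box 3 (∑ k ∈ Finset.range N, Lf k)))) a =
        (fun n : Fin N => (⟨(![(((n : ℕ) : ℕ) : ℤ), -((((n : ℕ) : ℕ) : ℤ)), 0] : Site 3), hmem n⟩ : ↥(box 3 (∑ k ∈ Finset.range N, Lf k)))) b → a = b := by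
    intro a _ b _ hab
    exact Fin.ext (planeDiag_injective (congrArg Subtype.val hab))
  have hnonneg : ∀ u : ↥(box 3 (∑ k ∈ Finset.range N, Lf k)),
      0 ≤ (if u.1 0 + u.1 1 + u.1 2 = 0 then PairIsing.gibbsAvg (fun a b : ↥(box 3 (∑ k ∈ Finset.range N, Lf k)) => if (((∑ i, |a.1 i - b.1 i| = 1) ∧ ¬ ((a.1 0 + a.1 1 + a.1 2 = 0 ∧ b.1 0 + b.1 1 + b.1 2 = 1) ∨ (a.1 0 + a.1 1 + a.1 2 = 1 ∧ b.1 0 + b.1 1 + b.1 2 = 0))) ∨ (((a.1 0 + a.1 1 + a.1 2 = 0 ∧ b.1 0 + b.1 1 + b.1 2 = 1) ∨ (a.1 0 + a.1 1 + a.1 2 = 1 ∧ b.1 0 + b.1 1 + b.1 2 = 0)) ∧ ∃ i : Fin 3, a.1 + b.1 = Pi.single i 1)) then (criticalBeta 3 / 2) * (if a.1 0 + a.1 1 + a.1 2 = 0 ∨ b.1 0 + b.1 1 + b.1 2 = 0 then J else 1) else 0) (fun s => spinAt (⟨(0 : Site 3), zero_mem_box 3 (∑ k ∈ Finset.range N,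 Lf k)⟩ : ↥(box 3 (∑ k ∈ Finset.range N, Lf k))) s * spinAt u s) ^ 2 else 0) := by
    intro u
    split_ifs
    · exact sq_nonneg _
    · exact le_rfl
  have hterm : ∀ n : Fin N, (m / 2) ^ 2 ≤
      (if (⟨(![(((n : ℕ) : ℕ) : ℤ), -((((n : ℕ) : ℕ) : ℤ)), 0] : Site 3), hmem n⟩ : ↥(box 3 (∑ k ∈ Finset.range N, Lf k))).1 0 + (⟨(![(((n : ℕ) : ℕ) : ℤ), -((((n : ℕ) : ℕ) : ℤ)), 0] : Site 3), hmem n⟩ : ↥(box 3 (∑ k ∈ Finset.range N, Lf k))).1 1 + (⟨(![(((n : ℕ) : ℕ) : ℤ), -((((n : ℕ) : ℕ) : ℤ)), 0] : Site 3), hmem n⟩ : ↥(box 3 (∑ k ∈ Finset.range N, Lf k))).1 2 = 0 then PairIsing.gibbsAvg (fun a b : ↥(box 3 (∑ k ∈ Finset.range N, Lf k)) => if (((∑ i, |a.1 i - b.1 i| = 1) ∧ ¬ ((a.1 0 + a.1 1 + a.1 2 = 0 ∧ b.1 0 + b.1 1 + b.1 2 = 1) ∨ (a.1 0 + a.1 1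 + a.1 2 = 1 ∧ b.1 0 + b.1 1 + b.1 2 = 0))) ∨ (((a.1 0 + a.1 1 + a.1 2 = 0 ∧ b.1 0 + b.1 1 + b.1 2 = 1) ∨ (a.1 0 + a.1 1 + a.1 2 = 1 ∧ b.1 0 + b.1 1 + b.1 2 = 0)) ∧ ∃ i : Fin 3, a.1 + b.1 = Pi.single i 1)) then (criticalBeta 3 / 2) * (if a.1 0 + a.1 1 + a.1 2 = 0 ∨ b.1 0 + b.1 1 + b.1 2 = 0 then J else 1) else 0) (fun s => spinAt (⟨(0 : Site 3), zero_mem_box 3 (∑ k ∈ Finset.range N, Lf k)⟩ : ↥(box 3 (∑ k ∈ Finset.range N, Lf k))) s * spinAt (⟨(![(((n : ℕ) : ℕ) : ℤ), -((((n : ℕ) : ℕ) : ℤ)), 0] : Site 3), hmem n⟩ : ↥(box 3 (∑ k ∈ Finset.range N, Lf k))) s) ^ 2 else 0) := by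
    intro n
    have hp : (⟨(![(((n : ℕ) : ℕ) : ℤ), -((((n : ℕ) : ℕ) : ℤ)), 0] : Site 3), hmem n⟩ : ↥(box 3 (∑ k ∈ Finset.range N, Lf k))).1 0 + (⟨(![(((n : ℕ) : ℕ) : ℤ), -((((n : ℕ) : ℕ) : ℤ)), 0] : Site 3), hmem n⟩ : ↥(box 3 (∑ k ∈ Finset.range N, Lf k))).1 1 + (⟨(![(((n : ℕ) : ℕ) : ℤ), -((((n : ℕ) : ℕ) : ℤ)), 0] : Site 3), hmem n⟩ : ↥(box 3 (∑ k ∈ Finset.range N, Lf k))).1 2 = 0 := planeDiag_plane n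
    rw [if_pos hp]
    have h1 : m / 2 < PairIsing.gibbsAvg (fun a b : ↥(box 3 (∑ k ∈ Finset.range N, Lf k)) => if (((∑ i, |a.1 i - b.1 i| = 1) ∧ ¬ ((a.1 0 + a.1 1 + a.1 2 = 0 ∧ b.1 0 + b.1 1 + b.1 2 = 1) ∨ (a.1 0 + a.1 1 + a.1 2 = 1 ∧ b.1 0 + b.1 1 + b.1 2 = 0))) ∨ (((a.1 0 + a.1 1 + a.1 2 = 0 ∧ b.1 0 + b.1 1 + b.1 2 = 1) ∨ (a.1 0 + a.1 1 + a.1 2 = 1 ∧ b.1 0 + b.1 1 + b.1 2 = 0)) ∧ ∃ i : Fin 3, a.1 + b.1 = Pi.single i 1)) then (criticalBeta 3 / 2) * (if a.1 0 + a.1 1 + a.1 2 = 0 ∨ b.1 0 + b.1 1 + b.1 2 = 0 then J else 1) else 0) (fun s => ∏ i, if h : (![(0 : Site 3), (![(((n : ℕ) : ℕ) : ℤ), -((((n : ℕ) : ℕ) : ℤ)), 0] : Site 3)] : Fin 2 → Site 3) i ∈ box 3 (∑ k ∈ Finset.range N, Lf k) then spinAt (⟨(![(0 : Site 3), (![(((n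 : ℕ) : ℕ) : ℤ), -((((n : ℕ) : ℕ) : ℤ)), 0] : Site 3)] : Fin 2 → Site 3) i, h⟩ : ↥(box 3 (∑ k ∈ Finset.range N, Lf k))) s else 0) :=
      (hLf n).2.trans_le (hvol J 2 (![(0 : Site 3), (![(((n : ℕ) : ℕ) : ℤ), -((((n : ℕ) : ℕ) : ℤ)), 0] : Site 3)] : Fin 2 → Site 3) (Lf n) (∑ k ∈ Finset.range N, Lf k) hJ (hLf_le n n.2))
    rw [obsTwo_eq_spinPair (∑ k ∈ Finset.range N, Lf k) (![(((n : ℕ) : ℕ) : ℤ), -((((n : ℕ) : ℕ) : ℤ)), 0] : Site 3) (hmem n)] at h1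
    exact pow_le_pow_left₀ (by positivity) h1.le 2
  calc B < (N : ℝ) * (m / 2) ^ 2 := hBN
    _ = ∑ _n : Fin N, (m / 2) ^ 2 := by simp
    _ ≤ ∑ n : Fin N, (if (⟨(![(((n : ℕ) : ℕ) : ℤ), -((((n : ℕ) : ℕ) : ℤ)), 0] : Site 3), hmem n⟩ : ↥(box 3 (∑ k ∈ Finset.range N, Lf k))).1 0 + (⟨(![(((n : ℕ) : ℕ) : ℤ), -((((n : ℕ) : ℕ) : ℤ)), 0] : Site 3), hmem n⟩ : ↥(box 3 (∑ k ∈ Finset.range N, Lf k))).1 1 + (⟨(![(((n : ℕ) : ℕ) : ℤ), -((((n : ℕ) : ℕ) : ℤ)), 0] : Site 3), hmem n⟩ : ↥(box 3 (∑ k ∈ Finset.range N, Lf k))).1 2 = 0 then PairIsing.gibbsAvg (fun a b : ↥(box 3 (∑ k ∈ Finset.range N, Lf k)) => if (((∑ i, |a.1 i - b.1 i| = 1) ∧ ¬ ((a.1 0 + a.1 1 + a.1 2 = 0 ∧ b.1 0 + b.1 1 + b.1 2 = 1) ∨ (a.1 0 + a.1 1 + a.1 2 = 1 ∧ b.1 0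 + b.1 1 + b.1 2 = 0))) ∨ (((a.1 0 + a.1 1 + a.1 2 = 0 ∧ b.1 0 + b.1 1 + b.1 2 = 1) ∨ (a.1 0 + a.1 1 + a.1 2 = 1 ∧ b.1 0 + b.1 1 + b.1 2 = 0)) ∧ ∃ i : Fin 3, a.1 + b.1 = Pi.single i 1)) then (criticalBeta 3 / 2) * (if a.1 0 + a.1 1 + a.1 2 = 0 ∨ b.1 0 + b.1 1 + b.1 2 = 0 then J else 1) else 0) (fun s => spinAt (⟨(0 : Site 3), zero_mem_box 3 (∑ k ∈ Finset.range N, Lf k)⟩ : ↥(box 3 (∑ k ∈ Finset.range N, Lf k))) s * spinAt (⟨(![(((n : ℕ) : ℕ) : ℤ), -((((n : ℕ) : ℕ) : ℤ)), 0] : Site 3), hmem n⟩ : ↥(box 3 (∑ k ∈ Finset.range N, Lf k))) s) ^ 2 else 0) :=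
        Finset.sum_le_sum fun n _ => hterm n
    _ = ∑ u ∈ (Finset.univ : Finset (Fin N)).image (fun n : Fin N => (⟨(![(((n : ℕ) : ℕ) : ℤ), -((((n : ℕ) : ℕ) : ℤ)), 0] : Site 3), hmem n⟩ : ↥(box 3 (∑ k ∈ Finset.range N, Lf k)))),
          (if u.1 0 + u.1 1 + u.1 2 = 0 then PairIsing.gibbsAvg (fun a b : ↥(box 3 (∑ k ∈ Finset.range N, Lf k)) => if (((∑ i, |a.1 i - b.1 i| = 1) ∧ ¬ ((a.1 0 + a.1 1 + a.1 2 = 0 ∧ b.1 0 + b.1 1 + b.1 2 = 1) ∨ (a.1 0 + a.1 1 + a.1 2 = 1 ∧ b.1 0 + b.1 1 + b.1 2 = 0))) ∨ (((a.1 0 + a.1 1 + a.1 2 = 0 ∧ b.1 0 + b.1 1 + b.1 2 = 1) ∨ (a.1 0 + a.1 1 + a.1 2 = 1 ∧ b.1 0 + b.1 1 + b.1 2 = 0)) ∧ ∃ i : Fin 3, a.1 + b.1 = Pi.single i 1)) then (criticalBeta 3 / 2) * (if a.1 0 + a.1 1 + a.1 2 = 0 ∨ b.1 0 + b.1 1 +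 b.1 2 = 0 then J else 1) else 0) (fun s => spinAt (⟨(0 : Site 3), zero_mem_box 3 (∑ k ∈ Finset.range N, Lf k)⟩ : ↥(box 3 (∑ k ∈ Finset.range N, Lf k))) s * spinAt u s) ^ 2 else 0) :=
        (Finset.sum_image (f := fun u : ↥(box 3 (∑ k ∈ Finset.range N, Lf k)) =>
          (if u.1 0 + u.1 1 + u.1 2 = 0 then PairIsing.gibbsAvg (fun a b : ↥(box 3 (∑ k ∈ Finset.range N, Lf k)) => if (((∑ i, |a.1 i - b.1 i| = 1) ∧ ¬ ((a.1 0 + a.1 1 + a.1 2 = 0 ∧ b.1 0 + b.1 1 + b.1 2 = 1) ∨ (a.1 0 + a.1 1 + a.1 2 = 1 ∧ b.1 0 + b.1 1 + b.1 2 = 0))) ∨ (((a.1 0 + a.1 1 + a.1 2 = 0 ∧ b.1 0 + b.1 1 + b.1 2 = 1) ∨ (a.1 0 + a.1 1 + a.1 2 = 1 ∧ b.1 0 + b.1 1 + b.1 2 = 0)) ∧ ∃ i : Fin 3, a.1 + b.1 = Pi.single i 1)) then (criticalBeta 3 / 2) * (if a.1 0 + a.1 1 + a.1 2 = 0 ∨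 b.1 0 + b.1 1 + b.1 2 = 0 then J else 1) else 0) (fun s => spinAt (⟨(0 : Site 3), zero_mem_box 3 (∑ k ∈ Finset.range N, Lf k)⟩ : ↥(box 3 (∑ k ∈ Finset.range N, Lf k))) s * spinAt u s) ^ 2 else 0)) hinj).symm
    _ ≤ (∑ u : ↥(box 3 (∑ k ∈ Finset.range N, Lf k)), if u.1 0 + u.1 1 + u.1 2 = 0 then PairIsing.gibbsAvg (fun a b : ↥(box 3 (∑ k ∈ Finset.range N, Lf k)) => if (((∑ i, |a.1 i - b.1 i| = 1) ∧ ¬ ((a.1 0 + a.1 1 + a.1 2 = 0 ∧ b.1 0 + b.1 1 + b.1 2 = 1) ∨ (a.1 0 + a.1 1 + a.1 2 = 1 ∧ b.1 0 + b.1 1 + b.1 2 = 0))) ∨ (((a.1 0 + a.1 1 + a.1 2 = 0 ∧ b.1 0 + b.1 1 + b.1 2 = 1) ∨ (a.1 0 + a.1 1 + a.1 2 = 1 ∧ b.1 0 + b.1 1 + b.1 2 = 0)) ∧ ∃ i : Fin 3, a.1 + b.1 = Pi.single i 1)) then (criticalBeta 3 / 2) * (if a.1 0 + a.1 1 + a.1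 2 = 0 ∨ b.1 0 + b.1 1 + b.1 2 = 0 then J else 1) else 0) (fun s => spinAt (⟨(0 : Site 3), zero_mem_box 3 (∑ k ∈ Finset.range N, Lf k)⟩ : ↥(box 3 (∑ k ∈ Finset.range N, Lf k))) s * spinAt u s) ^ 2 else 0) :=
        Finset.sum_le_sum_of_subset_of_nonneg (Finset.subset_univ _) (fun u _ _ => hnonneg u)

/-! ## A strictly positive ordered coupling -/

/-- From stub (S) (landed) and the `J = 0` anchor: some `J > 0` has plane long-range order. [folklore] -/
theorem exists_pos_lro : ∃ J : ℝ, 0 < J ∧ (∃ m : ℝ, 0 < m ∧ ∀ c : Site 3, c 0 + c 1 + c 2 = 0 → m ≤ (⨆ L : ℕ, PairIsing.gibbsAvg (fun a b : ↥(box 3 L) => if (((∑ i, |a.1 i - b.1 i| = 1) ∧ ¬ ((a.1 0 + a.1 1 + a.1 2 = 0 ∧ b.1 0 + b.1 1 + b.1 2 = 1) ∨ (a.1 0 + a.1 1 + a.1 2 = 1 ∧ b.1 0 + b.1 1 + b.1 2 = 0))) ∨ (((a.1 0 + a.1 1 + a.1 2 = 0 ∧ b.1 0 + b.1 1 + b.1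 2 = 1) ∨ (a.1 0 + a.1 1 + a.1 2 = 1 ∧ b.1 0 + b.1 1 + b.1 2 = 0)) ∧ ∃ i : Fin 3, a.1 + b.1 = Pi.single i 1)) then (criticalBeta 3 / 2) * (if a.1 0 + a.1 1 + a.1 2 = 0 ∨ b.1 0 + b.1 1 + b.1 2 = 0 then J else 1) else 0) (fun s => ∏ i, if h : (![(0 : Site 3), c] : Fin 2 → Site 3) i ∈ box 3 L then spinAt (⟨(![(0 : Site 3), c] : Fin 2 → Site 3) i, h⟩ : ↥(box 3 L)) s else 0))) := by
  have hS := Summit.CriticalPhenomena.Ising3DConformalLimit.Cruxes.TwinThreshold.SeamRenewal.stub_strongSeamOrder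
  beta_reduce at hS
  obtain ⟨J, hJ, hL⟩ := hS
  refine ⟨J, lt_of_le_of_ne hJ ?_, hL⟩
  rintro rfl
  exact not_lro_zero hL

/-! ## The two guard kills -/

/-- **The DISORDER guard of (C2) is load-bearing.** Stub `stub_bubbleIntegrable` with `J < J'' → ¬ LRO J''` deleted is
FALSE: at the ordered coupling `J₀ > 0` of (S) the thick-plane bubble at base point `0` is unbounded over boxes, so no
real number `Bf J₀` bounds it. [folklore] -/
theorem stub_bubbleIntegrable_false_without_disorderGuard : ¬ (∃ Bf : ℝ → ℝ, (∀ J₁ : ℝ, IntervalIntegrable Bf MeasureTheory.volume 0 J₁) ∧ ∀ J : ℝ, 0 ≤ J → ∀ (L : ℕ) (x : ↥(box 3 L)), x.1 0 + x.1 1 + x.1 2 = 0 → (∑ u : ↥(box 3 L), if (u.1 0 + u.1 1 + u.1 2 = -1 ∨ u.1 0 + u.1 1 + u.1 2 = 0 ∨ u.1 0 + u.1 1 + u.1 2 = 1) then PairIsing.gibbsAvg (fun a b : ↥(box 3 L) => if (((∑ i, |a.1 i - b.1 i| = 1) ∧ ¬ ((a.1 0 + a.1 1 + a.1 2 = 0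 ∧ b.1 0 + b.1 1 + b.1 2 = 1) ∨ (a.1 0 + a.1 1 + a.1 2 = 1 ∧ b.1 0 + b.1 1 + b.1 2 = 0))) ∨ (((a.1 0 + a.1 1 + a.1 2 = 0 ∧ b.1 0 + b.1 1 + b.1 2 = 1) ∨ (a.1 0 + a.1 1 + a.1 2 = 1 ∧ b.1 0 + b.1 1 + b.1 2 = 0)) ∧ ∃ i : Fin 3, a.1 + b.1 = Pi.single i 1)) then (criticalBeta 3 / 2) * (if a.1 0 + a.1 1 + a.1 2 = 0 ∨ b.1 0 + b.1 1 + b.1 2 = 0 then J else 1) else 0) (fun s => spinAt x s * spinAt u s) ^ 2 else 0) ≤ Bf J) := by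
  rintro ⟨Bf, -, hB⟩
  obtain ⟨J, hJ, m, hm, hLRO⟩ := exists_pos_lro
  obtain ⟨L, hL⟩ := planeBubble_unbounded_of_lro hJ.le hm hLRO (Bf J)
  have hx0 : (⟨(0 : Site 3), zero_mem_box 3 L⟩ : ↥(box 3 L)).1 0 + (⟨(0 : Site 3), zero_mem_box 3 L⟩ : ↥(box 3 L)).1 1 + (⟨(0 : Site 3), zero_mem_box 3 L⟩ : ↥(box 3 L)).1 2 = 0 := by simp
  have h := hB J hJ.le L (⟨(0 : Site 3), zero_mem_box 3 L⟩ : ↥(box 3 L)) hx0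
  exact absurd (hL.trans_le ((planeBubble_le_bubble J L).trans h)) (lt_irrefl _)

/-- **The SIGN guard of (C2) is load-bearing.** Stub `stub_bubbleIntegrable` with `0 ≤ J` deleted is FALSE: the
negative coupling `-J₀` lies below the disordered coupling `J'' = 0` (`not_lro_zero`), so the majorant must bound the
bubble at `-J₀`; by evenness of plane–plane box correlators (`planeBubble_neg`) its plane part equals the one at `J₀`,
unbounded over boxes. [folklore] -/
theorem stub_bubbleIntegrable_false_without_nonnegGuard : ¬ (∃ Bf : ℝ → ℝ, (∀ J₁ : ℝ, IntervalIntegrable Bf MeasureTheory.volume 0 J₁) ∧ ∀ J J'' : ℝ, J < J'' → ¬ (∃ m : ℝ, 0 < m ∧ ∀ c : Site 3, c 0 + c 1 + c 2 = 0 → m ≤ (⨆ L : ℕ, PairIsing.gibbsAvg (fun a b : ↥(box 3 L) => if (((∑ i, |a.1 i - b.1 i| = 1) ∧ ¬ ((a.1 0 + a.1 1 + a.1 2 = 0 ∧ b.1 0 + b.1 1 + b.1 2 = 1) ∨ (a.1 0 + a.1 1 + a.1 2 = 1 ∧ b.1 0 + b.1 1 + b.1 2 = 0))) ∨ (((a.1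 0 + a.1 1 + a.1 2 = 0 ∧ b.1 0 + b.1 1 + b.1 2 = 1) ∨ (a.1 0 + a.1 1 + a.1 2 = 1 ∧ b.1 0 + b.1 1 + b.1 2 = 0)) ∧ ∃ i : Fin 3, a.1 + b.1 = Pi.single i 1)) then (criticalBeta 3 / 2) * (if a.1 0 + a.1 1 + a.1 2 = 0 ∨ b.1 0 + b.1 1 + b.1 2 = 0 then J'' else 1) else 0) (fun s => ∏ i, if h : (![(0 : Site 3), c] : Fin 2 → Site 3) i ∈ box 3 L then spinAt (⟨(![(0 : Site 3), c] : Fin 2 → Site 3) i, h⟩ : ↥(box 3 L)) s else 0))) → ∀ (L : ℕ) (x : ↥(box 3 L)), x.1 0 + x.1 1 + x.1 2 = 0 → (∑ u : ↥(box 3 L), if (u.1 0 + u.1 1 + u.1 2 = -1 ∨ u.1 0 + u.1 1 + u.1 2 = 0 ∨ u.1 0 + u.1 1 + u.1 2 = 1) then PairIsing.gibbsAvg (fun a b : ↥(box 3 L) => if (((∑ i, |a.1 i - b.1 i| = 1) ∧ ¬ ((a.1 0 + a.1 1 + a.1 2 = 0 ∧ b.1 0 + b.1 1 + b.1 2 =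 1) ∨ (a.1 0 + a.1 1 + a.1 2 = 1 ∧ b.1 0 + b.1 1 + b.1 2 = 0))) ∨ (((a.1 0 + a.1 1 + a.1 2 = 0 ∧ b.1 0 + b.1 1 + b.1 2 = 1) ∨ (a.1 0 + a.1 1 + a.1 2 = 1 ∧ b.1 0 + b.1 1 + b.1 2 = 0)) ∧ ∃ i : Fin 3, a.1 + b.1 = Pi.single i 1)) then (criticalBeta 3 / 2) * (if a.1 0 + a.1 1 + a.1 2 = 0 ∨ b.1 0 + b.1 1 + b.1 2 = 0 then J else 1) else 0) (fun s => spinAt x s * spinAt u s) ^ 2 else 0) ≤ Bf J) := by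
  rintro ⟨Bf, -, hB⟩
  obtain ⟨J, hJ, m, hm, hLRO⟩ := exists_pos_lro
  obtain ⟨L, hL⟩ := planeBubble_unbounded_of_lro hJ.le hm hLRO (Bf (-J))
  have hx0 : (⟨(0 : Site 3), zero_mem_box 3 L⟩ : ↥(box 3 L)).1 0 + (⟨(0 : Site 3), zero_mem_box 3 L⟩ : ↥(box 3 L)).1 1 + (⟨(0 : Site 3), zero_mem_box 3 L⟩ : ↥(box 3 L)).1 2 = 0 := by simp
  have h := hB (-J) 0 (by linarith) not_lro_zero L (⟨(0 : Site 3), zero_mem_box 3 L⟩ : ↥(box 3 L)) hx0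
  have hle := planeBubble_le_bubble (-J) L
  rw [planeBubble_neg J L] at hle
  exact absurd (hL.trans_le (hle.trans h)) (lt_irrefl _)

end Summit.CriticalPhenomena.Ising3DConformalLimit.Theorems.TwinThreshold.Negative

end
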